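import Mathlib.CategoryTheory.Comma.Over.Pullback
import Mathlib.CategoryTheory.Equivalence
import Mathlib.CategoryTheory.ObjectProperty.FullSubcategory
import Literature.AlgebraicGeometry.Frobenioids.Categories
import Literature.AnabelianGeometry.EtaleTheta.CyclotomicEnvelope
import HarnessLib

/-!
# [SemiAnbd] §0 Notations and Conventions: the items not already in the tree (pp. 5–9)

Mochizuki, *Semi-graphs of anabelioids*, Publ. RIMS **42** (2006) 221–322, §0, author's manuscript
pp. 5–9 [cite: MochizukiSemiAnbd2006, §0 pp.5-9].  Most of §0 coincides verbatim with [FrdI] §0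
and is the tree's `Literature.AlgebraicGeometry.Frobenioids.Categories` /
`CategoriesFactorization` (slices `C_A`, `(j_A)_!`, `f_!`, rigid functors, slim categories, `0`/`1`-
commutativity, connected / mobile / quasi-connected objects, totally epimorphic, finitely /
countably connected type, `C⁰`, `C^⊥`, `C^⊤`, connected categories, minimal-adjoint arrows); the
paragraph "Topological Groups" (centralizer, normalizer, commensurator, commensurably terminal) is
Mathlib + `AbsoluteAnabelian/ProfiniteTerminology`; "Curves" (pp. 9–10: families of curves,
`M̄_{g,r}`, hyperbolic curves of type `(g,r)`, stable log curves, isogenous curves) is vocabulary of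
algebraic geometry not typed here.  This file adds the remaining items:

* the *outer semi-direct product* `G ⋊^out J := Aut(G) ×_{Out(G)} J` for `J → Out(G)` (p. 5), over
  the tree's `EtaleTheta.contMulAut` / `EtaleTheta.TopOut` (bi-continuous automorphisms modulo inner
  ones, from `EtaleTheta/CyclotomicEnvelope.lean` — reused, not re-declared); the exactness claims of
  p. 5 for centre-free `G` as a NAMED FACT;
* `C[A] ⊆ C`, the full subcategory of objects admitting a morphism to `A` (p. 6); the dictionary
  `j_A^* = Over.star A`, `f^* = Over.pullback f` (p. 6);
* *abstract equivalence* of functors (p. 7);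
* *indissectible* objects (p. 9).
-/

/-! ### Outer semi-direct products (p. 5) -/

namespace Literature.AnabelianGeometry.SemiGraphs

section OuterSemidirect

open Literature.AnabelianGeometry.EtaleTheta

variable {G : Type*} [Group G] [TopologicalSpace G]

/-- The *outer semi-direct product* `G ⋊^out J := Aut(G) ×_{Out(G)} J` of `J` with the topological
group `G` along a homomorphism `J → Out(G)` (p. 5), as the fibre-product subgroup of `Aut(G) × J`;
here `Aut(G)` = the tree's `EtaleTheta.contMulAut G` (bi-continuous automorphisms) and
`Out(G)` = `EtaleTheta.TopOut G`. [cite: MochizukiSemiAnbd2006, §0 p.5] -/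
def outerSemidirectProduct {J : Type*} [Group J] (ρ : J →* TopOut G) :
    Subgroup (contMulAut G × J) where
  carrier := {p | TopOut.mk G p.1 = ρ p.2}
  one_mem' := by simp
  mul_mem' {p q} hp hq := by
    simp only [Set.mem_setOf_eq, Prod.fst_mul, Prod.snd_mul, map_mul] at hp hq ⊢
    rw [hp, hq]
  inv_mem' {p} hp := by
    simp only [Set.mem_setOf_eq, Prod.fst_inv, Prod.snd_inv, map_inv] at hp ⊢
    rw [hp]

/-- The natural map `G → G ⋊^out J`, `g ↦ (conj g, 1)` (the first map of the sequence
`1 → G → G ⋊^out J → J → 1`, p. 5). [cite: MochizukiSemiAnbd2006, §0 p.5] -/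
def toOuterSemidirectProduct [IsTopologicalGroup G] {J : Type*} [Group J] (ρ : J →* TopOut G) :
    G →* outerSemidirectProduct ρ where
  toFun g := ⟨(⟨MulAut.conj g, innerAut_le_contMulAut G ⟨g, rfl⟩⟩, 1), by
    change TopOut.mk G _ = ρ 1
    rw [map_one, QuotientGroup.mk'_apply, QuotientGroup.eq_one_iff]
    exact ⟨g, rfl⟩⟩
  map_one' := by ext <;> simp
  map_mul' g h := by ext <;> simp

/-- The projection `G ⋊^out J → J` (p. 5). [cite: MochizukiSemiAnbd2006, §0 p.5] -/
def outerSemidirectProductSnd {J : Type*} [Group J] (ρ : J →* TopOut G) :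
    outerSemidirectProduct ρ →* J :=
  (MonoidHom.snd (contMulAut G) J).comp (outerSemidirectProduct ρ).subtype

/-- NAMED FACT (p. 5): if `G` is centre-free then `1 → G → Aut(G) → Out(G) → 1` is exact ("the
injective [since `G` is center-free!] homomorphism `G → Aut(G)`") and "we have a natural exact
sequence `1 → G → G ⋊^out J → J → 1`": injectivity of `G → G ⋊^out J`, exactness in the middle,
surjectivity onto `J`. [cite: MochizukiSemiAnbd2006, §0 p.5] -/
def outerSemidirectProduct_exact : Prop :=
  ∀ (G : Type) [Group G] [TopologicalSpace G] [IsTopologicalGroup G], Subgroup.center G = ⊥ →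
    ∀ (J : Type) [Group J] (ρ : J →* TopOut G),
    Function.Injective (toOuterSemidirectProduct ρ) ∧
      (toOuterSemidirectProduct ρ).range = (outerSemidirectProductSnd ρ).ker ∧
      Function.Surjective (outerSemidirectProductSnd ρ)

end OuterSemidirect

/-! ### Categories (pp. 6–9): the items not in `Frobenioids.Categories` -/

section Categories

open CategoryTheory

universe v v₁ v₂ v₃ v₄ u u₁ u₂ u₃ u₄

variable {C : Type u} [Category.{v} C]

/-- `C[A] ⊆ C`: "the full subcategory determined by the objects of `C` that admit a morphism to `A`"
(p. 6), as an object property. [cite: MochizukiSemiAnbd2006, §0 p.6] -/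
def admitsHomTo (A : C) : ObjectProperty C := fun B => Nonempty (B ⟶ A)

/-- The full subcategory `C[A]` (p. 6). [cite: MochizukiSemiAnbd2006, §0 p.6] -/
abbrev Over' (A : C) := (admitsHomTo A).FullSubcategory

/-- `j_A^* : C → C_A`, "given by taking the product with `A`" (p. 6) — Mathlib's `Over.star A`
(right adjoint to `(j_A)_! = Over.forget A`). [cite: MochizukiSemiAnbd2006, §0 p.6] -/
noncomputable abbrev prodSlice [Limits.HasBinaryProducts C] (A : C) : C ⥤ Over A := Over.star A

/-- `f^* : C_B → C_A`, "given by taking the fibered product over `B` with `A`" (p. 6) — Mathlib's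
`Over.pullback f` (right adjoint to `f_! = Over.map f`). [cite: MochizukiSemiAnbd2006, §0 p.6] -/
noncomputable abbrev pullbackSlice [Limits.HasPullbacks C] {A B : C} (f : A ⟶ B) :
    Over B ⥤ Over A :=
  Over.pullback f

variable {C₁ : Type u₁} [Category.{v₁} C₁] {C₂ : Type u₂} [Category.{v₂} C₂]
  {D₁ : Type u₃} [Category.{v₃} D₁] {D₂ : Type u₄} [Category.{v₄} D₂]

/-- An *abstract equivalence* from `Φ₁ : C₁ → D₁` to `Φ₂ : C₂ → D₂` (p. 7): a 1-commutative square
whose horizontal arrows are equivalences of categories `C₁ ⥲ C₂`, `D₁ ⥲ D₂`.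
[cite: MochizukiSemiAnbd2006, §0 p.7] -/
structure AbstractEquivalence (Φ₁ : C₁ ⥤ D₁) (Φ₂ : C₂ ⥤ D₂) where
  /-- the equivalence of sources -/
  top : C₁ ≌ C₂
  /-- the equivalence of targets -/
  bot : D₁ ≌ D₂
  /-- the square 1-commutes -/
  iso : top.functor ⋙ Φ₂ ≅ Φ₁ ⋙ bot.functor

/-- `Φ₁`, `Φ₂` are *abstractly equivalent* if there exists an abstract equivalence from `Φ₁` to `Φ₂`
(p. 7). [cite: MochizukiSemiAnbd2006, §0 p.7] -/
def AreAbstractlyEquivalent (Φ₁ : C₁ ⥤ D₁) (Φ₂ : C₂ ⥤ D₂) : Prop :=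
  Nonempty (AbstractEquivalence Φ₁ Φ₂)

open Literature.AlgebraicGeometry.Frobenioids in
/-- An object `A` is *indissectible* (p. 9): for every pair of arrows `φ₁ : A₁ → A`, `φ₂ : A₂ → A`
with `A₁`, `A₂` nonempty there exist a nonempty `B` and arrows `ψ₁ : B → A₁`, `ψ₂ : B → A₂` with
`φ₁ ∘ ψ₁ = φ₂ ∘ ψ₂` ("nonempty" = non-initial, as in `Frobenioids.IsNonemptyObj`).
[cite: MochizukiSemiAnbd2006, §0 p.9] -/
def IsIndissectible (A : C) : Prop :=
  ∀ (A₁ A₂ : C) (φ₁ : A₁ ⟶ A) (φ₂ : A₂ ⟶ A), IsNonemptyObj A₁ → IsNonemptyObj A₂ →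
    ∃ (B : C) (ψ₁ : B ⟶ A₁) (ψ₂ : B ⟶ A₂), IsNonemptyObj B ∧ ψ₁ ≫ φ₁ = ψ₂ ≫ φ₂

end Categories

end Literature.AnabelianGeometry.SemiGraphs
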